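/-
CITATION HEADER
  module   : Literature.MathematicalPhysics.QuantumFieldTheory.Balaban1983to89.B6LayerSharp
  package  : pub-balaban (surge node prover #09 gen 4, node 21, journal claim G-B6-LAYER-SHARP)
  papers   : [Balaban1984PropagatorsII] T. Balaban, "Propagators and renormalization transformations for lattice
             gauge theories. II", Commun. Math. Phys. 96 (1984) 223–250 — Lemma 2.4, p. 245.
  printed  : the ONLY printed text this module refers to is the layer sentence of p. 245 [PDF 23] (between (2.126)
             and (2.127)), quoted verbatim in `B6LayerOptimal` / `B6LayerCosine` (XREAD-verified there, C-A32-1,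
             C-ref5-101); it is not re-quoted here.  Everything below is [folklore] mathematics ABOUT the optimal
             constant of that sentence; nothing of the paper is asserted.
  status   : kernel-checked, 0 sorry; all declarations [folklore].
-/
import Literature.MathematicalPhysics.QuantumFieldTheory.Balaban1983to89.B6LayerCosine
import Literature.MathematicalPhysics.QuantumFieldTheory.Balaban1983to89.B6Lemma24Printed

/-!
# B6 Lemma 2.4 — the layer constant identified: `κ_opt(L) = min{1, 4L sin²(π/(2L))}`

`B6LayerOptimal` defined the optimal constant `kappaOpt d L` of the p. 245 layer sentence (typed as
`B6Lemma24Kappa.LayerIneq d L κ`) and proved `LayerIneq d L κ ↔ κ ≤ kappaOpt d L`, `kappaOpt d L = kappaOpt 2 L`,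
`kappaOpt = 1 ↔ L ≤ 9`; `B6LayerCosine` proved the upper bound `kappaOpt d L ≤ 4L sin²(π/(2L))` by testing the
one-dimensional form `B6LayerDimTwo.PathIneq` on the Neumann eigenfunction.  This module proves the matching LOWER
bound and hence the exact value, for every `d ≥ 2`, `L ≥ 2`:

* §1 `dirichlet_ground_state` — the discrete ground-state (Picone) bound for the Dirichlet path: if `ψ > 0` on
  `1 … n`, `ψ(0) = ψ(n+1) = 0` and `ψ(t−1) + ψ(t+1) = c·ψ(t)`, then `(2 − c)·Σ_{t=1}^{n} w(t)² ≤ Σ_{s=0}^{n} (w(s+1) − w(s))²`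
  for every `w` with `w(0) = w(n+1) = 0` (per edge: `(b − a)(y²/b − x²/a) ≤ (y − x)²`, `picone_edge`);
* §2 `dirichlet_path_sin` — with `ψ(t) = sin(πt/L)`: the SHARP Dirichlet Poincaré inequality on `L − 1` points,
  constant `2 − 2cos(π/L)`;
* §3 `neumann_path_sin` — the sharp mean-zero (Neumann) Poincaré inequality on `L` points,
  `(2 − 2cos(π/L))·(ΣU² − (ΣU)²/L) ≤ Σ(U(s+1) − U(s))²`, from §2 applied to the PARTIAL SUMS of `U − mean`
  (which vanish at both ends), summation by parts and Cauchy–Schwarz (the variance identity is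
  `B6Lemma24Printed.sum_sq_sub_mean`, reused by name);
* §4 `pathIneq_min` — `PathIneq L (min 1 (4L sin²(π/(2L))))` (`L(2 − 2cos(π/L)) = 4L sin²(π/(2L))`,
  `B6LayerCosine.two_sub_two_cos_eq`);
* §5 **`kappaOpt_eq_min : kappaOpt d L = min 1 (4L sin²(π/(2L)))`**, `layerIneq_iff_le_min`, `pathIneq_iff_le_min`,
  and for `L ≥ 10` **`kappaOpt_eq_sin : kappaOpt d L = 4L sin²(π/(2L))`** (`< π²/L < 1`).

So the constant of the printed sentence is exactly `κ_L = min{1, 4L sin²(π/2L)}` — the value recorded (unproved) in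
the cell's `Lemma24-repair.md` (G-B6-10); both halves are now kernel-checked.  HONEST SCOPE: nothing here concerns
(2.128) itself (its printed constant `1/(12d²)` at `κ = 1` is the separate module `B6Lemma24Printed`).
-/

namespace Literature.MathematicalPhysics.QuantumFieldTheory.Balaban1983to89.B6LayerSharp

open Finset Real
open B6Lemma24Kappa (LayerIneq)
open B6LayerDimTwo (PathIneq)
open B6LayerTensor (layerIneq_iff_pathIneq)
open B6LayerUpperBound (sum_Ico_int_eq_sum_range)
open B6LayerOptimal (kappaOpt kappaOpt_mem layerIneq_iff_le kappaOpt_le_one)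
open B6LayerCosine (two_sub_two_cos_eq kappaOpt_le_sin sin_bound_lt_pi_sq_div pi_sq_div_lt_one)
open B6Lemma24Printed (sum_sq_sub_mean)

variable {d L : ℕ}

/-! ## §1  The discrete Picone inequality and the ground-state bound for the Dirichlet path -/

/-- **Picone's inequality on one edge**: for weights `a, b ≥ 0` and values `x, y` vanishing where the weight does,
`(b − a)(y²/b − x²/a) ≤ (y − x)²` (for `a, b > 0` the defect is `(ay − bx)²/(ab)`; Lean's `x/0 = 0`). [folklore] -/
theorem picone_edge {a b x y : ℝ} (ha : 0 ≤ a) (hb : 0 ≤ b) (hax : a = 0 → x = 0) (hby : b = 0 → y = 0) :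
    (b - a) * (y ^ 2 / b - x ^ 2 / a) ≤ (y - x) ^ 2 := by
  rcases ha.eq_or_lt with ha0 | ha0
  · have hx : x = 0 := hax ha0.symm
    subst hx
    rw [← ha0, div_zero, sub_zero, sub_zero, sub_zero]
    rcases hb.eq_or_lt with hb0 | hb0
    · rw [← hb0, zero_mul]; positivity
    · rw [mul_div_cancel₀ _ hb0.ne']
  · rcases hb.eq_or_lt with hb0 | hb0
    · have hy : y = 0 := hby hb0.symm
      subst hy
      rw [← hb0, div_zero, zero_sub, zero_sub, zero_sub, neg_mul_neg, mul_div_cancel₀ _ ha0.ne', neg_sq]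
    · have key : (y - x) ^ 2 - (b - a) * (y ^ 2 / b - x ^ 2 / a) = (a * y - b * x) ^ 2 / (a * b) := by
        field_simp
        ring
      have hnn : 0 ≤ (a * y - b * x) ^ 2 / (a * b) := by positivity
      linarith

/-- **Discrete ground-state (Picone) bound for the Dirichlet path on `n` points.**  If `ψ(0) = ψ(n+1) = 0`,
`ψ(t) > 0` and `ψ(t−1) + ψ(t+1) = c·ψ(t)` for `1 ≤ t ≤ n`, then every `w` with `w(0) = w(n+1) = 0` satisfies
`(2 − c) Σ_{t=1}^{n} w(t)² ≤ Σ_{s=0}^{n} (w(s+1) − w(s))²` (sum the edge inequalities for `g = w²/ψ` and use the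
eigen-relation on the cross terms). [folklore] -/
theorem dirichlet_ground_state (n : ℕ) (w ψ : ℕ → ℝ) (c : ℝ) (hw0 : w 0 = 0) (hwn : w (n + 1) = 0)
    (hψ0 : ψ 0 = 0) (hψn : ψ (n + 1) = 0) (hψpos : ∀ t, 1 ≤ t → t ≤ n → 0 < ψ t)
    (heig : ∀ t, 1 ≤ t → t ≤ n → ψ (t - 1) + ψ (t + 1) = c * ψ t) :
    (2 - c) * ∑ s ∈ range n, w (s + 1) ^ 2 ≤ ∑ s ∈ range (n + 1), (w (s + 1) - w s) ^ 2 := by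
  set g : ℕ → ℝ := fun t => w t ^ 2 / ψ t with hg
  set S : ℝ := ∑ s ∈ range n, w (s + 1) ^ 2 with hS
  have hψnn : ∀ t, t ≤ n + 1 → 0 ≤ ψ t := by
    intro t ht
    rcases Nat.eq_zero_or_pos t with h0 | h0
    · rw [h0, hψ0]
    · rcases eq_or_lt_of_le ht with h1 | h1
      · rw [h1, hψn]
      · exact (hψpos t h0 (by omega)).le
  have hzero : ∀ t, t ≤ n + 1 → ψ t = 0 → w t = 0 := by
    intro t ht hz
    rcases Nat.eq_zero_or_pos t with h0 | h0
    · rw [h0, hw0]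
    · rcases eq_or_lt_of_le ht with h1 | h1
      · rw [h1, hwn]
      · exact absurd hz (hψpos t h0 (by omega)).ne'
  have hA : ∀ t, t ≤ n + 1 → ψ t * g t = w t ^ 2 := by
    intro t ht
    by_cases hz : ψ t = 0
    · simp [hg, hz, hzero t ht hz]
    · simp only [hg]
      field_simp
  -- (1) the edge inequalities, summed
  have hedge : ∑ s ∈ range (n + 1), (ψ (s + 1) - ψ s) * (g (s + 1) - g s)
      ≤ ∑ s ∈ range (n + 1), (w (s + 1) - w s) ^ 2 := by
    refine sum_le_sum fun s hs => ?_
    have hs' := mem_range.mp hs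
    exact picone_edge (hψnn s (by omega)) (hψnn (s + 1) (by omega)) (hzero s (by omega))
      (hzero (s + 1) (by omega))
  -- (2) expand the left side
  have hexp : ∑ s ∈ range (n + 1), (ψ (s + 1) - ψ s) * (g (s + 1) - g s)
      = (∑ s ∈ range (n + 1), ψ (s + 1) * g (s + 1)) + (∑ s ∈ range (n + 1), ψ s * g s)
        - ((∑ s ∈ range (n + 1), ψ s * g (s + 1)) + ∑ s ∈ range (n + 1), ψ (s + 1) * g s) := by
    rw [← sum_add_distrib, ← sum_add_distrib, ← sum_sub_distrib]
    exact sum_congr rfl fun s _ => by ring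
  have h1 : ∑ s ∈ range (n + 1), ψ (s + 1) * g (s + 1) = S := by
    rw [sum_range_succ, hA (n + 1) le_rfl, hwn]
    simp only [ne_eq, OfNat.ofNat_ne_zero, not_false_eq_true, zero_pow, add_zero]
    exact sum_congr rfl fun s hs => hA (s + 1) (by have := mem_range.mp hs; omega)
  have h2 : ∑ s ∈ range (n + 1), ψ s * g s = S := by
    rw [sum_range_succ', hA 0 (Nat.zero_le _), hw0]
    simp only [ne_eq, OfNat.ofNat_ne_zero, not_false_eq_true, zero_pow, add_zero]
    exact sum_congr rfl fun s hs => hA (s + 1) (by have := mem_range.mp hs; omega)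
  have hg0 : g 0 = 0 := by simp [hg, hw0]
  have hgn : g (n + 1) = 0 := by simp [hg, hwn]
  have h3 : ∑ s ∈ range (n + 1), ψ s * g (s + 1) = ∑ s ∈ range n, ψ s * g (s + 1) := by
    rw [sum_range_succ, hgn, mul_zero, add_zero]
  have h4 : ∑ s ∈ range (n + 1), ψ (s + 1) * g s = ∑ s ∈ range n, ψ (s + 1 + 1) * g (s + 1) := by
    rw [sum_range_succ', hg0, mul_zero, add_zero]
  have h5 : (∑ s ∈ range n, ψ s * g (s + 1)) + ∑ s ∈ range n, ψ (s + 1 + 1) * g (s + 1) = c * S := by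
    rw [← sum_add_distrib, hS, mul_sum]
    refine sum_congr rfl fun s hs => ?_
    have hs' := mem_range.mp hs
    have he := heig (s + 1) (by omega) (by omega)
    rw [Nat.add_sub_cancel] at he
    have hA' := hA (s + 1) (by omega)
    calc ψ s * g (s + 1) + ψ (s + 1 + 1) * g (s + 1) = (ψ s + ψ (s + 1 + 1)) * g (s + 1) := by ring
      _ = c * (ψ (s + 1) * g (s + 1)) := by rw [he]; ring
      _ = c * w (s + 1) ^ 2 := by rw [hA']
  have hL : ∑ s ∈ range (n + 1), (ψ (s + 1) - ψ s) * (g (s + 1) - g s) = (2 - c) * S := by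
    rw [hexp, h1, h2, h3, h4, h5]; ring
  rw [← hL]
  exact hedge

/-! ## §2  The sine ground state: the sharp Dirichlet Poincaré inequality on `L − 1` points -/

/-- The sine profile `sin(πt/L)` satisfies the three-term eigen-relation with `c = 2cos(π/L)`. [folklore] -/
theorem sin_profile_eigen (L : ℕ) (t : ℕ) (ht : 1 ≤ t) :
    sin (π * (t - 1 : ℕ) / L) + sin (π * (t + 1 : ℕ) / L) = 2 * cos (π / L) * sin (π * t / L) := by
  rw [Nat.cast_sub ht]
  push_cast
  have e1 : π * ((t : ℝ) - 1) / L = π * t / L - π / L := by ring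
  have e2 : π * ((t : ℝ) + 1) / L = π * t / L + π / L := by ring
  rw [e1, e2, sin_sub, sin_add]
  ring

/-- **Sharp Dirichlet Poincaré inequality for the path** (`L ≥ 2`; `w(0) = w(L) = 0`):
`(2 − 2cos(π/L)) Σ_{t=1}^{L−1} w(t)² ≤ Σ_{s=0}^{L−1} (w(s+1) − w(s))²`, by §1 with `ψ(t) = sin(πt/L)`. [folklore] -/
theorem dirichlet_path_sin (hL : 2 ≤ L) (w : ℕ → ℝ) (hw0 : w 0 = 0) (hwL : w L = 0) :
    (2 - 2 * cos (π / L)) * ∑ s ∈ range (L - 1), w (s + 1) ^ 2 ≤ ∑ s ∈ range L, (w (s + 1) - w s) ^ 2 := by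
  obtain ⟨n, rfl⟩ : ∃ n, L = n + 1 := ⟨L - 1, by omega⟩
  rw [Nat.add_sub_cancel]
  have hL0 : (0 : ℝ) < (n + 1 : ℕ) := by positivity
  refine dirichlet_ground_state n w (fun t => sin (π * t / (n + 1 : ℕ))) (2 * cos (π / (n + 1 : ℕ))) hw0 hwL
    ?_ ?_ ?_ ?_
  · simp
  · show sin (π * ((n + 1 : ℕ) : ℝ) / (n + 1 : ℕ)) = 0
    rw [mul_div_assoc, div_self hL0.ne', mul_one, sin_pi]
  · intro t ht1 htn
    show 0 < sin (π * t / (n + 1 : ℕ))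
    apply sin_pos_of_pos_of_lt_pi
    · have : (0 : ℝ) < t := by exact_mod_cast ht1
      positivity
    · rw [div_lt_iff₀ hL0]
      have : (t : ℝ) < (n + 1 : ℕ) := by exact_mod_cast (Nat.lt_succ_of_le htn)
      nlinarith [pi_pos]
  · intro t ht1 _
    exact sin_profile_eigen (n + 1) t ht1

/-! ## §3  From Dirichlet to Neumann: the sharp mean-zero Poincaré inequality on `L` points -/

/-- Summation by parts with vanishing ends: `φ(0) = φ(n+1) = 0` gives
`Σ_{s≤n} f(s)(φ(s+1) − φ(s)) = −Σ_{s<n} φ(s+1)(f(s+1) − f(s))`. [folklore] -/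
theorem abel_vanishing_ends (n : ℕ) (f φ : ℕ → ℝ) (hφ0 : φ 0 = 0) (hφn : φ (n + 1) = 0) :
    ∑ s ∈ range (n + 1), f s * (φ (s + 1) - φ s) = -∑ s ∈ range n, φ (s + 1) * (f (s + 1) - f s) := by
  have h1 : ∑ s ∈ range (n + 1), f s * φ (s + 1) = ∑ s ∈ range n, f s * φ (s + 1) := by
    rw [sum_range_succ, hφn, mul_zero, add_zero]
  have h2 : ∑ s ∈ range (n + 1), f s * φ s = ∑ s ∈ range n, f (s + 1) * φ (s + 1) := by
    rw [sum_range_succ', hφ0, mul_zero, add_zero]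
  calc ∑ s ∈ range (n + 1), f s * (φ (s + 1) - φ s)
      = ∑ s ∈ range (n + 1), f s * φ (s + 1) - ∑ s ∈ range (n + 1), f s * φ s := by
        rw [← sum_sub_distrib]; exact sum_congr rfl fun s _ => by ring
    _ = ∑ s ∈ range n, f s * φ (s + 1) - ∑ s ∈ range n, f (s + 1) * φ (s + 1) := by rw [h1, h2]
    _ = -∑ s ∈ range n, φ (s + 1) * (f (s + 1) - f s) := by
        rw [← sum_sub_distrib, ← sum_neg_distrib]; exact sum_congr rfl fun s _ => by ring

/-- **Sharp mean-zero (Neumann) Poincaré inequality for the path on `L ≥ 2` points**: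
`(2 − 2cos(π/L))·(Σ_{s<L} U(s)² − (Σ_{s<L} U(s))²/L) ≤ Σ_{s<L−1} (U(s+1) − U(s))²`.  Proof: the partial sums `φ` of
`v = U − mean` vanish at `0` and at `L`; §2 gives `(2 − 2cos(π/L)) Σφ² ≤ Σv²`; summation by parts gives
`Σv² = −Σ φ(s+1)(U(s+1) − U(s))`, and Cauchy–Schwarz closes. [folklore] -/
theorem neumann_path_sin (hL : 2 ≤ L) (U : ℕ → ℝ) :
    (2 - 2 * cos (π / L)) * (∑ s ∈ range L, U s ^ 2 - (∑ s ∈ range L, U s) ^ 2 / L)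
      ≤ ∑ s ∈ range (L - 1), (U (s + 1) - U s) ^ 2 := by
  obtain ⟨n, rfl⟩ : ∃ n, L = n + 1 := ⟨L - 1, by omega⟩
  rw [Nat.add_sub_cancel]
  set lam : ℝ := 2 - 2 * cos (π / (n + 1 : ℕ)) with hlam
  set m : ℝ := (∑ t ∈ range (n + 1), U t) / (n + 1 : ℕ) with hm
  set v : ℕ → ℝ := fun s => U s - m with hv
  set φ : ℕ → ℝ := fun t => ∑ s ∈ range t, v s with hφ
  set V : ℝ := ∑ s ∈ range (n + 1), v s ^ 2 with hV
  set G : ℝ := ∑ s ∈ range n, (U (s + 1) - U s) ^ 2 with hG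
  set P : ℝ := ∑ s ∈ range n, φ (s + 1) ^ 2 with hP
  -- the variance identity
  have hVar : V = ∑ s ∈ range (n + 1), U s ^ 2 - (∑ s ∈ range (n + 1), U s) ^ 2 / (n + 1 : ℕ) := by
    have h := (sum_sq_sub_mean (range (n + 1)) U (by rw [card_range]; positivity)).1
    rw [card_range] at h
    rw [hV, ← h]
  rw [← hVar]
  -- λ > 0 via L(2 − 2cos(π/L)) = 4L sin²(π/(2L))
  have hL1 : (1 : ℝ) ≤ (n + 1 : ℕ) := by exact_mod_cast (Nat.le_add_left 1 n)
  have hL0 : (0 : ℝ) < (n + 1 : ℕ) := by positivity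
  have hlam0 : 0 < lam := by
    have e := two_sub_two_cos_eq (L := n + 1) (by omega)
    have hs : 0 < sin (π / (2 * (n + 1 : ℕ))) := by
      apply sin_pos_of_pos_of_lt_pi
      · positivity
      · rw [div_lt_iff₀ (by positivity)]; nlinarith [pi_pos]
    have h4 : 0 < 4 * ((n + 1 : ℕ) : ℝ) * sin (π / (2 * (n + 1 : ℕ))) ^ 2 := by positivity
    rw [← e] at h4
    exact pos_of_mul_pos_right h4 hL0.le
  -- the partial sums vanish at both ends
  have hφ0 : φ 0 = 0 := by simp [hφ]
  have hvsum : ∑ s ∈ range (n + 1), v s = 0 := by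
    simp only [hv, sum_sub_distrib, sum_const, card_range, nsmul_eq_mul, hm]
    field_simp
    ring
  have hφn : φ (n + 1) = 0 := by rw [hφ]; exact hvsum
  have hφstep : ∀ s, φ (s + 1) - φ s = v s := fun s => by simp [hφ, sum_range_succ]
  -- Dirichlet for φ:  λ P ≤ Σ (φ(s+1) − φ s)² = V
  have hD : lam * P ≤ V := by
    have h := dirichlet_path_sin (L := n + 1) (by omega) φ hφ0 hφn
    rw [Nat.add_sub_cancel] at h
    have hE : ∑ s ∈ range (n + 1), (φ (s + 1) - φ s) ^ 2 = V := by
      rw [hV]; exact sum_congr rfl fun s _ => by rw [hφstep]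
    rw [hE] at h
    exact h
  -- summation by parts:  V = −Σ φ(s+1)(U(s+1) − U s)
  have hSBP : V = -∑ s ∈ range n, φ (s + 1) * (U (s + 1) - U s) := by
    have h := abel_vanishing_ends n v φ hφ0 hφn
    have hl : ∑ s ∈ range (n + 1), v s * (φ (s + 1) - φ s) = V := by
      rw [hV]; exact sum_congr rfl fun s _ => by rw [hφstep]; ring
    rw [hl] at h
    rw [h]
    congr 1
    exact sum_congr rfl fun s _ => by simp only [hv]; ring
  -- Cauchy–Schwarz:  V² ≤ P·G
  have hCS : V ^ 2 ≤ P * G := by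
    rw [hSBP, neg_sq, hP, hG]
    exact sum_mul_sq_le_sq_mul_sq (range n) (fun s => φ (s + 1)) (fun s => U (s + 1) - U s)
  -- conclude
  have hV0 : 0 ≤ V := by rw [hV]; exact sum_nonneg fun s _ => sq_nonneg _
  have hG0 : 0 ≤ G := by rw [hG]; exact sum_nonneg fun s _ => sq_nonneg _
  rcases hV0.eq_or_lt with hV00 | hVpos
  · rw [← hV00, mul_zero]; exact hG0
  · -- λ V² ≤ λ P G ≤ V G
    have h1 : lam * V ^ 2 ≤ V * G := by
      calc lam * V ^ 2 ≤ lam * (P * G) := by gcongr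
        _ = (lam * P) * G := by ring
        _ ≤ V * G := by gcongr
    have h2 : lam * V * V ≤ G * V := by
      calc lam * V * V = lam * V ^ 2 := by ring
        _ ≤ V * G := h1
        _ = G * V := by ring
    exact le_of_mul_le_mul_right h2 hVpos

/-! ## §4  The path inequality at the sharp constant -/

/-- **`PathIneq L (min 1 (4L sin²(π/(2L))))`** for `L ≥ 2`: the sharp constant is admissible in the one-dimensional
form of the layer inequality (§3 + `L(2 − 2cos(π/L)) = 4L sin²(π/(2L))`; the `min 1` absorbs the mean term
`(Σu)²/L`, whose coefficient in `PathIneq` is exactly `1`). [folklore] -/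
theorem pathIneq_min (hL : 2 ≤ L) : PathIneq L (min 1 (4 * L * sin (π / (2 * L)) ^ 2)) := by
  intro u
  set U : ℕ → ℝ := fun s => u (s : ℤ) with hU
  set K : ℝ := 4 * L * sin (π / (2 * L)) ^ 2 with hK
  have hL1 : 1 ≤ L := by omega
  have hL0 : (0 : ℝ) < L := by exact_mod_cast (by omega : 0 < L)
  -- convert the three ℤ-indexed sums to range sums
  have hA : ∑ a ∈ Ico (0 : ℤ) L, u a ^ 2 = ∑ s ∈ range L, U s ^ 2 :=
    sum_Ico_int_eq_sum_range L (fun a => u a ^ 2)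
  have hB : ∑ a ∈ Ico (0 : ℤ) L, u a = ∑ s ∈ range L, U s := sum_Ico_int_eq_sum_range L u
  have hGz : ∑ a ∈ Ico (0 : ℤ) L, (if a + 1 < (L : ℤ) then (u (a + 1) - u a) ^ 2 else 0)
      = ∑ s ∈ range (L - 1), (U (s + 1) - U s) ^ 2 := by
    rw [sum_Ico_int_eq_sum_range L (fun a => if a + 1 < (L : ℤ) then (u (a + 1) - u a) ^ 2 else 0)]
    obtain ⟨n, rfl⟩ : ∃ n, L = n + 1 := ⟨L - 1, by omega⟩
    rw [Nat.add_sub_cancel, sum_range_succ]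
    have hlast : (if ((n : ℕ) : ℤ) + 1 < ((n + 1 : ℕ) : ℤ) then (u ((n : ℤ) + 1) - u n) ^ 2 else 0) = 0 := by
      rw [if_neg (by push_cast; omega)]
    rw [hlast, add_zero]
    refine sum_congr rfl fun s hs => ?_
    have hs' := mem_range.mp hs
    rw [if_pos (by push_cast; omega)]
    simp only [hU]
    push_cast
    ring_nf
  rw [hA, hB, hGz]
  set A : ℝ := ∑ s ∈ range L, U s ^ 2 with hA'
  set B : ℝ := ∑ s ∈ range L, U s with hB'
  set G : ℝ := ∑ s ∈ range (L - 1), (U (s + 1) - U s) ^ 2 with hG'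
  -- §3 and the identity L(2 − 2cos(π/L)) = K
  have hN := neumann_path_sin hL U
  rw [← hA', ← hB', ← hG'] at hN
  have hKe : (L : ℝ) * (2 - 2 * cos (π / L)) = K := two_sub_two_cos_eq hL1
  have hmain : K * (A - B ^ 2 / L) ≤ L * G := by
    have := mul_le_mul_of_nonneg_left hN hL0.le
    rw [← mul_assoc, hKe] at this
    exact this
  have hvar0 : 0 ≤ A - B ^ 2 / L := by
    rw [sub_nonneg, div_le_iff₀ hL0]
    have hcs := sq_sum_le_card_mul_sum_sq (s := range L) (f := U)
    rw [card_range, ← hA', ← hB'] at hcs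
    linarith
  have hK0 : 0 ≤ K := by positivity
  have hB2 : 0 ≤ B ^ 2 / L := by positivity
  rcases le_or_gt K 1 with hK1 | hK1
  · rw [min_eq_right hK1]
    -- K A ≤ K(A − B²/L) + B²/L ≤ L G + B²/L, using (1 − K) B²/L ≥ 0
    have : K * A ≤ K * (A - B ^ 2 / L) + B ^ 2 / L := by nlinarith
    linarith
  · rw [min_eq_left hK1.le, one_mul]
    -- A − B²/L ≤ K (A − B²/L) ≤ L G
    have : A - B ^ 2 / L ≤ K * (A - B ^ 2 / L) := by nlinarith
    linarith

/-! ## §5  The layer constant identified -/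

/-- **The optimal constant of the p. 245 layer sentence, identified**: for every `d ≥ 2`, `L ≥ 2`,
`kappaOpt d L = min{1, 4L sin²(π/(2L))}`. [folklore] -/
theorem kappaOpt_eq_min (hd : 2 ≤ d) (hL : 2 ≤ L) :
    kappaOpt d L = min 1 (4 * L * sin (π / (2 * L)) ^ 2) := by
  refine le_antisymm (le_min (kappaOpt_le_one hd (by omega)) (kappaOpt_le_sin hd hL)) ?_
  exact (layerIneq_iff_le hd (by omega)).1 ((layerIneq_iff_pathIneq hd (by omega) _).2 (pathIneq_min hL))

/-- **The layer sentence holds with constant `κ` iff `κ ≤ min{1, 4L sin²(π/(2L))}`** (`d ≥ 2`, `L ≥ 2`). [folklore] -/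
theorem layerIneq_iff_le_min (hd : 2 ≤ d) (hL : 2 ≤ L) {κ : ℝ} :
    LayerIneq d L κ ↔ κ ≤ min 1 (4 * L * sin (π / (2 * L)) ^ 2) := by
  rw [layerIneq_iff_le hd (by omega), kappaOpt_eq_min hd hL]

/-- The same for the one-dimensional form: `PathIneq L κ ↔ κ ≤ min{1, 4L sin²(π/(2L))}` (`L ≥ 2`). [folklore] -/
theorem pathIneq_iff_le_min (hL : 2 ≤ L) {κ : ℝ} :
    PathIneq L κ ↔ κ ≤ min 1 (4 * L * sin (π / (2 * L)) ^ 2) := by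
  rw [← layerIneq_iff_pathIneq (d := 2) le_rfl (by omega), layerIneq_iff_le_min le_rfl hL]

/-- For `L ≥ 10` the minimum is the sine term: **`kappaOpt d L = 4L sin²(π/(2L))`** (`< π²/L < 1`), the sharp value
strictly below the printed `1`. [folklore] -/
theorem kappaOpt_eq_sin (hd : 2 ≤ d) (hL : 10 ≤ L) : kappaOpt d L = 4 * L * sin (π / (2 * L)) ^ 2 := by
  rw [kappaOpt_eq_min hd (by omega), min_eq_right]
  exact ((sin_bound_lt_pi_sq_div (by omega)).trans (pi_sq_div_lt_one hL)).le

/-- For `2 ≤ L ≤ 9` the minimum is `1` (consistent with `B6LayerOptimal.kappaOpt_eq_one_iff`):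
`1 ≤ 4L sin²(π/(2L))` there (`B6LayerCosine.one_le_sin_bound_of_le_nine`). [folklore] -/
theorem kappaOpt_eq_one_of_le_nine' (hd : 2 ≤ d) (hL : 2 ≤ L) (hL9 : L ≤ 9) : kappaOpt d L = 1 := by
  rw [kappaOpt_eq_min hd hL, min_eq_left (B6LayerCosine.one_le_sin_bound_of_le_nine hL hL9)]

/-- **Summary** (`d ≥ 2`, `L ≥ 2`): the admissible constants of the printed layer sentence are exactly
`κ ≤ min{1, 4L sin²(π/(2L))}`; in particular the printed `κ = 1` is admissible iff `4L sin²(π/(2L)) ≥ 1` iff `L ≤ 9`,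
and for `L ≥ 10` the best constant is the Neumann spectral gap value `4L sin²(π/(2L)) ∈ [8/L, π²/L)`. [folklore] -/
theorem layer_constant_identified (hd : 2 ≤ d) (hL : 2 ≤ L) :
    kappaOpt d L = min 1 (4 * L * sin (π / (2 * L)) ^ 2) ∧
      (∀ κ : ℝ, LayerIneq d L κ ↔ κ ≤ min 1 (4 * L * sin (π / (2 * L)) ^ 2)) ∧
      (10 ≤ L → kappaOpt d L = 4 * L * sin (π / (2 * L)) ^ 2 ∧ kappaOpt d L < 1) :=
  ⟨kappaOpt_eq_min hd hL, fun _ => layerIneq_iff_le_min hd hL, fun h10 =>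
    ⟨kappaOpt_eq_sin hd h10, by
      rw [kappaOpt_eq_sin hd h10]
      exact (sin_bound_lt_pi_sq_div (by omega)).trans (pi_sq_div_lt_one h10)⟩⟩

end Literature.MathematicalPhysics.QuantumFieldTheory.Balaban1983to89.B6LayerSharp
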